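import Mathlib.Algebra.FreeAlgebra
import Literature.Computability.AlgebraicComplexity.ValiantConjectureEquivProofs
import Summits.ValiantsHypothesis.Statement
import HarnessLib

/-!
# NcSemantics — route-independent noncommutative semantics of `ArithCircuit` and the ordered permanent
(decomposition workshop `decomp-valiant`, lens 6 «restricted-models lifting axis», gen 5; supports
`DecompCycle1.PerNotSmVP`, stmt-ValiantsHypothesis-23661; CONE HYGIENE for the asides
stmt-ValiantsHypothesis-23446 `PerNotNcVP`, -23447 `NcLift`, -23448 `SmToNcPer`)

WHY THIS FILE EXISTS. `Theorems/CommutativityDial.lean` (gen 4) introduced the noncommutative reading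
`ncEval : ArithCircuit k σ → FreeAlgebra k σ` of the tree's circuit syntax and the ordered permanent
`ncPerPoly`, but that file imports the route file `Theses/DecompCycle1.lean` (it proves edges to the
route's items). A route file may import `Summits.<P>.Theorems.*` only when no import cycle results, so
the route `DecompCycle1` cannot import `CommutativityDial` to give its asides 23446–23448 a Lean
signature (writer ROUTE-EDITED 2026-08-29T23:08:41Z, critic 22:51:54Z / 00:05:21Z: "NcSemantics hoist").
Landed Theorems files are append-only, so the definitions cannot be moved; this module RE-HOMES them
with IDENTICAL BODIES in a module that imports only `Mathlib`, `Literature` and `HarnessLib`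
(importable by any Theses file), together with every theorem of `CommutativityDial` §§1–4 that does not
mention a route item. The companion file `Theorems/NcSemanticsBridge.lean` proves that the two copies
agree definitionally (`CommutativityDial.ncEval = NcSemantics.ncEval`, … , `PerNotNcVP ↔`, `NcLift ↔`)
so that every gen-4 kernel theorem (Nisan rung, HWY10 Thm F.1 transfer, `AP_k`, SOS road) transports.

CONTENT (all sorry-free, verbatim from `CommutativityDial` §§1–4 with the namespace changed):
* §1 `ncOperandEval`, `ncGateEval`, `ncGateValues`, `ncEval`, `comm`, and `comm_ncEval : comm (ncEval P) = P.eval`;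
* §2 `ncPerPoly n = ∑_π X_(π 0,0) ⋯ X_(π (n-1),n-1)`, `comm_ncPerPoly`, `computes_perPoly_of_ncEval`;
* §3 the pieces `PerNotNcVP` (`A_nc`) and `NcLift` (`B_nc`) over `ℂ`, route-free;
* §4 `closes : PerNotNcVP → NcLift → ValiantsHypothesis`, `perNotNcVP_of_vh`, `ncLift_of_vh`,
  `ncLift_iff_residual`, `summit_iff_split : S ↔ A_nc ∧ B_nc`.
Deliberately NOT here: anything mentioning `PerNotSmVP` / `TameOrSmLift` (route items) — those edges
stay in `CommutativityDial` §5 / `NcOrderedTransfer` / `CommutativityDialSplit` and are transported by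
the bridge. HONEST FRAMING: nothing here is evidence for `VP ≠ VNP`; `A_nc` is an open problem, `B_nc`
its exact residual (see `CommutativityDial` for the full discussion, roads and barrier placement).

## References

* [HrubesWigdersonYehudayoff2011] P. Hrubeš, A. Wigderson, A. Yehudayoff, *Non-commutative circuits
  and the sum-of-squares problem*, STOC 2010 / J. AMS 24 (2011), §1.1, Thm 1.7, Thm 1.11.
* [Nisan1991Noncommutative] N. Nisan, *Lower bounds for non-commutative computation*, STOC 1991, §1, Thm 1.
* [Burgisser2000] P. Bürgisser, *Completeness and Reduction in Algebraic Complexity Theory*, Def. 2.1.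
-/

noncomputable section

namespace Summit.ValiantsHypothesis.ValiantsHypothesis.Theorems.NcSemantics

open Literature.Computability.AlgebraicComplexity
open MvPolynomial

universe u v

variable {k : Type u} {σ : Type v} [CommSemiring k]

/-! ## §1 Noncommutative semantics of the tree's circuit syntax -/

/-- Noncommutative value of an operand against the list of nc values of the earlier gates:
`var i ↦ X i` (free generator), `const c ↦ c · 1`, `gate j ↦ vals[j]` (junk `0` out of range), exactly
as `ArithCircuit.Operand.eval` but in the free algebra (Nisan 1991 §1; HWY10 §2). Same body as
`CommutativityDial.ncOperandEval` (bridge: `NcSemanticsBridge.ncOperandEval_eq`).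
[cite: Nisan1991Noncommutative, §1] -/
def ncOperandEval (vals : List (FreeAlgebra k σ)) : ArithCircuit.Operand k σ → FreeAlgebra k σ
  | .var i => FreeAlgebra.ι k i
  | .const c => algebraMap k (FreeAlgebra k σ) c
  | .gate j => vals.getD j 0

/-- Noncommutative value of a gate: weighted sum, resp. ORDERED product of its operands (the operand
list order is the multiplication order). Same body as `CommutativityDial.ncGateEval`.
[cite: Nisan1991Noncommutative, §1] -/
def ncGateEval (vals : List (FreeAlgebra k σ)) : ArithCircuit.Gate k σ → FreeAlgebra k σ
  | .sum args => (args.map fun a => a.1 • ncOperandEval vals a.2).sum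
  | .prod args => (args.map fun u => ncOperandEval vals u).prod

/-- The list of nc values of a gate list (left fold, as `ArithCircuit.gateValues`). Same body as
`CommutativityDial.ncGateValues`. [cite: Nisan1991Noncommutative, §1] -/
def ncGateValues (gs : List (ArithCircuit.Gate k σ)) : List (FreeAlgebra k σ) :=
  gs.foldl (fun vals g => vals ++ [ncGateEval vals g]) []

/-- The NONCOMMUTATIVE polynomial computed by a circuit: the same syntax (`ArithCircuit k σ`, size =
number of gates, `IsFanInTwo` as in the tree) read in the free algebra `FreeAlgebra k σ`. Same body
as `CommutativityDial.ncEval`. [cite: Nisan1991Noncommutative, §1] -/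
def ncEval (P : ArithCircuit k σ) : FreeAlgebra k σ :=
  ncOperandEval (ncGateValues P.gates) P.output

/-- The commutative image `FreeAlgebra k σ →ₐ[k] MvPolynomial σ k`, `X i ↦ X i`. [folklore] -/
def comm : FreeAlgebra k σ →ₐ[k] MvPolynomial σ k :=
  FreeAlgebra.lift k fun i => (X i : MvPolynomial σ k)

/-- `comm (X i) = X i`. [folklore] -/
@[simp] theorem comm_ι (i : σ) : comm (FreeAlgebra.ι k i) = (X i : MvPolynomial σ k) := by
  simp [comm]

/-- One step of the fold defining `ncGateValues`. [folklore] -/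
@[simp] theorem ncGateValues_append_singleton (gs : List (ArithCircuit.Gate k σ))
    (g : ArithCircuit.Gate k σ) :
    ncGateValues (gs ++ [g]) = ncGateValues gs ++ [ncGateEval (ncGateValues gs) g] := by
  simp [ncGateValues, List.foldl_append]

/-- The commutative image of an operand's nc value is its commutative value. [folklore] -/
theorem comm_ncOperandEval (vals : List (FreeAlgebra k σ)) (u : ArithCircuit.Operand k σ) :
    comm (ncOperandEval vals u) = u.eval (vals.map comm) := by
  cases u with
  | var i => simp [ncOperandEval, ArithCircuit.Operand.eval]
  | const c => simp [ncOperandEval, ArithCircuit.Operand.eval, AlgHom.commutes, MvPolynomial.algebraMap_eq]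
  | gate j =>
    simp only [ncOperandEval, ArithCircuit.Operand.eval_gate]
    rw [← map_zero (comm (k := k) (σ := σ)), List.getD_map]

/-- The commutative image of a gate's nc value is its commutative value. [folklore] -/
theorem comm_ncGateEval (vals : List (FreeAlgebra k σ)) (g : ArithCircuit.Gate k σ) :
    comm (ncGateEval vals g) = g.eval (vals.map comm) := by
  cases g with
  | sum args =>
    simp [ncGateEval, ArithCircuit.Gate.eval, map_list_sum, List.map_map, Function.comp_def,
      comm_ncOperandEval]
  | prod args =>
    simp [ncGateEval, ArithCircuit.Gate.eval, map_list_prod, List.map_map, Function.comp_def,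
      comm_ncOperandEval]

/-- The commutative images of the nc gate values are the commutative gate values. [folklore] -/
theorem map_comm_ncGateValues (gs : List (ArithCircuit.Gate k σ)) :
    (ncGateValues gs).map comm = ArithCircuit.gateValues gs := by
  induction gs using List.reverseRecOn with
  | nil => simp [ncGateValues, ArithCircuit.gateValues]
  | append_singleton gs g ih =>
    rw [ncGateValues_append_singleton, ArithCircuit.gateValues_append_singleton, List.map_append,
      List.map_singleton, comm_ncGateEval, ih]

/-- COMMUTATIVE IMAGE LEMMA: reading a circuit noncommutatively and then letting the variables
commute gives the polynomial it computes commutatively (HWY10 §1: "any lower bound for commutative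
circuits is a lower bound for non-commutative circuits"). [cite: HrubesWigdersonYehudayoff2011, §1.1] -/
theorem comm_ncEval (P : ArithCircuit k σ) : comm (ncEval P) = P.eval := by
  rw [ncEval, comm_ncOperandEval, map_comm_ncGateValues]
  rfl

/-! ## §2 The ordered (noncommutative) permanent -/

/-- The ORDERED PERMANENT `∑_π X_(π 0,0) X_(π 1,1) ⋯ X_(π (n-1),n-1)` in the free algebra on the `n²`
matrix positions: the `t`-th factor is the variable of COLUMN `t` (the tree's `perPoly` convention
`∏ᵢ X_(π i, i)`). Same body as `CommutativityDial.ncPerPoly`.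
[cite: HrubesWigdersonYehudayoff2011, §1.3 eq. PERM_n] -/
def ncPerPoly (n : ℕ) : FreeAlgebra k (Fin n × Fin n) :=
  ∑ π : Equiv.Perm (Fin n), (List.ofFn fun i : Fin n => FreeAlgebra.ι k (π i, i)).prod

/-- The commutative image of the ordered permanent is the permanent. [folklore] -/
theorem comm_ncPerPoly (n : ℕ) : comm (ncPerPoly (k := k) n) = perPoly (Fin n) k := by
  simp [ncPerPoly, map_sum, map_list_prod, List.prod_ofFn, perPoly, Matrix.permanent,
    Matrix.mvPolynomialX]

/-- An nc circuit computing the ordered permanent computes `perPoly` commutatively. [folklore] -/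
theorem computes_perPoly_of_ncEval {n : ℕ} {P : ArithCircuit k (Fin n × Fin n)}
    (h : ncEval P = ncPerPoly n) : P.Computes (perPoly (Fin n) k) := by
  rw [ArithCircuit.Computes, ← comm_ncEval, h, comm_ncPerPoly]

/-! ## §3 Pieces (route-free) -/

/-- PIECE `A_nc` — THE PERMANENT HAS NO POLYNOMIAL-SIZE NONCOMMUTATIVE CIRCUITS (i.o. form, over
`ℂ`): for every exponent `c` there is an `n` such that every fan-in-two circuit whose noncommutative
value is the ordered permanent `ncPerPoly n` has more than `n^c + c` gates. Route-free copy of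
`CommutativityDial.PerNotNcVP` (bridge: `NcSemanticsBridge.perNotNcVP_iff`); intended signature of the
aside stmt-ValiantsHypothesis-23446. TAG: WEAKER·NECESSARY (`perNotNcVP_of_vh`); `A_nc ⟹ S` NOT KNOWN
(HWY10, remark after Thm 1.11). STATUS: OPEN PROBLEM (no superpolynomial lower bound for general
noncommutative circuits is known, HWY10 §1.1). [cite: HrubesWigdersonYehudayoff2011, Thm 1.7, Thm 1.11; Nisan1991Noncommutative, Thm 1] -/
@[conjecture] def PerNotNcVP : Prop :=
  ∀ c : ℕ, ∃ n : ℕ, ∀ P : ArithCircuit ℂ (Fin n × Fin n), P.IsFanInTwo →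
    ncEval P = ncPerPoly n → n ^ c + c < P.size

/-- PIECE `B_nc` — THE NONCOMMUTATIVE LIFTING RESIDUAL: if `VP_ℂ = VNP_ℂ` then the ordered permanent
has fan-in-two noncommutative circuits of polynomial size. Route-free copy of `CommutativityDial.NcLift`
(bridge: `NcSemanticsBridge.ncLift_iff`); intended signature of the aside stmt-ValiantsHypothesis-23447.
TAG: DECLARED-RESIDUAL · vacuous under `S` (`ncLift_of_vh`) · EXACT (`ncLift_iff_residual`) · IDEA-NEEDED.
[cite: HrubesWigdersonYehudayoff2011, Thm F.1] -/
@[conjecture] def NcLift : Prop :=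
  VP ℂ = VNP ℂ → ∃ c : ℕ, ∀ n : ℕ, ∃ P : ArithCircuit ℂ (Fin n × Fin n), P.IsFanInTwo ∧
    ncEval P = ncPerPoly n ∧ P.size ≤ n ^ c + c

/-! ## §4 Deciding theorems -/

/-- NODE: `S ⟸ A_nc ∧ B_nc` (a.e./i.o. clash at the polynomial threshold). [folklore] -/
theorem closes (hA : PerNotNcVP) (hB : NcLift) : _root_.ValiantsHypothesis := by
  intro heq
  obtain ⟨c, hc⟩ := hB heq
  obtain ⟨n, hn⟩ := hA c
  obtain ⟨P, h2, hP, hs⟩ := hc n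
  exact absurd hs (not_le_of_gt (hn P h2 hP))

/-- NECESSITY of `A_nc` (kernel): `S ⟹ A_nc`, because an nc circuit for the ordered permanent is a
commutative circuit for `per` of the same size (`computes_perPoly_of_ncEval`,
`ArithCircuit.complexity_le_size`) and `S` says `per` is not p-computable
(`perNotPComputableComplex_iff_holds`). [folklore] -/
theorem perNotNcVP_of_vh (hS : _root_.ValiantsHypothesis) : PerNotNcVP := by
  intro c
  have hS' := perNotPComputableComplex_iff_holds.mpr hS
  by_contra h
  simp only [not_exists, not_forall, not_lt] at h
  apply hS'
  refine ⟨c, fun n => ?_⟩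
  obtain ⟨P, hfan, hcomp, hsize⟩ := h n
  exact (ArithCircuit.complexity_le_size hfan (computes_perPoly_of_ncEval hcomp)).trans hsize

/-- `B_nc` is (vacuously) implied by `S`. [folklore] -/
theorem ncLift_of_vh (hS : _root_.ValiantsHypothesis) : NcLift := fun heq => absurd heq hS

/-- `B_nc` is EXACTLY the residual of `A_nc`. [folklore] -/
theorem ncLift_iff_residual : NcLift ↔ (PerNotNcVP → _root_.ValiantsHypothesis) := by
  refine ⟨fun hB hA => closes hA hB, fun h heq => ?_⟩
  have hA : ¬ PerNotNcVP := fun hA => h hA heq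
  simp only [PerNotNcVP, not_forall, not_exists, not_lt, exists_prop] at hA
  exact hA

/-- THE NODE IS AN EXACT CONJUNCT SPLIT: `S ⟺ A_nc ∧ B_nc`. [folklore] -/
theorem summit_iff_split : _root_.ValiantsHypothesis ↔ PerNotNcVP ∧ NcLift :=
  ⟨fun hS => ⟨perNotNcVP_of_vh hS, ncLift_of_vh hS⟩, fun h => closes h.1 h.2⟩

end Summit.ValiantsHypothesis.ValiantsHypothesis.Theorems.NcSemantics

end
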